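import Summits.FinalStateConjecture.FinalStateConjecture.Theses.PhotonSphereChannels
import Summits.FinalStateConjecture.FinalStateConjecture.Theses.EternalPapapetrou
import Summits.FinalStateConjecture.FinalStateConjecture.Cruxes.ChannelsResolveTameDevelopmentsR.Disproof
import Summits.FinalStateConjecture.FinalStateConjecture.Theorems.PhotonSphereChannelsTameHullDefs
import Summits.FinalStateConjecture.FinalStateConjecture.Theorems.PhaseMixingCaptureCaptureSufficesTameSettlingKickReduction
import HarnessLib

/-!
# Strategist s4 (independent census) — typed intermediates around `ChannelsResolveTameDevelopmentsR`

Scratch file of the SECOND independent strategy census (seat s4, family `s`) for crux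
`stmt-FinalStateConjecture-17430` = `Theses.PhotonSphereChannels.ChannelsResolveTameDevelopmentsR` (K2R).
Nothing here is a registered line; everything is sorry-free. It types and PROVES the purely logical
relations the census `STRATEGY-CENSUS-s4.md` relies on:

* `K2RAt k` — the crux with hypothesis (ii) taken at differentiability order `k` (`K2RAt 3 ↔ K2R`,
  `k2RAt_three_iff`), monotone in `k` (`k2RAt_mono`: larger `k` = STRONGER hypothesis = WEAKER statement);
  `K2RAllOrders` — (ii) at all orders; `k2RAllOrders_of_k2RAt`. These are the honest "strictly weaker
  intermediates" of inventory (1): the registered line `tame-lasalle-dock` in fact only reaches `K2RAllOrders`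
  through its producer (`IsTameClass.order : ∀ k`), see the census §1/§2.
* `TameUpgrade` + `k2R_of_completeScriSettlesC0_of_tameUpgrade` /
  `completeScriSettlesC0_onTameClass_of_k2R` — the two-piece DOCK of K2R onto the sibling route's target
  `Theses.EternalPapapetrou.CompleteScriSettlesC0` (stmt-FinalStateConjecture-17273): inventory (2)/(3).
-/

noncomputable section

set_option maxSynthPendingDepth 3
set_option linter.dupNamespace false

open Set Filter Function TopologicalSpace
open scoped Manifold ContDiff Topology ENNReal NNReal

namespace Summit.FinalStateConjecture.FinalStateConjecture.Cruxes.ChannelsResolveTameDevelopmentsR.StrategistS4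

open Literature.Geometry.Lorentzian
open Summit.FinalStateConjecture (HasCompleteNullInfinity exteriorOf RaysStayInClosure HasExhaustiveCharts
  IsFutureOriented)
open Summit.FinalStateConjecture.FinalStateConjecture.Theorems.TameHull (NoExtremalRemnant outerRegion TameOuter)
open Summit.FinalStateConjecture.FinalStateConjecture.Theses.PhotonSphereChannels (ChannelsResolveTameDevelopmentsR)
open Summit.FinalStateConjecture.FinalStateConjecture.Theses.EternalPapapetrou (CompleteScriSettlesC0)
open Summit.FinalStateConjecture.FinalStateConjecture.Cruxes.ChannelsResolveTameDevelopmentsR.Disproof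
  (TameResolution k2R_of_tameResolution tameResolution_of_k2R)
open Summit.FinalStateConjecture.FinalStateConjecture.Theorems.PhaseMixingCaptureCaptureSufficesTame
  (hasExhaustiveCharts_ofLE isFutureOriented_ofLE)

/-! ## §0 Named pieces of the crux (verbatim sub-formulas with the order as a parameter) -/

section Pieces

variable {X : Type} [TopologicalSpace X] [ChartedSpace E3 X] [IsManifold (𝓡 3) ∞ X]
  [T2Space X] [SecondCountableTopology X] [ConnectedSpace X] {D : InitialDataSet (𝓡 3) X}

/-- The T2 settling conclusion of the crux at convergence order `k` (the crux has `k = 2`; the sibling target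
`CompleteScriSettlesC0` has `k = 0`), verbatim otherwise. [folklore] -/
def SettlesAt (k : ℕ) (𝒟 : VacuumCauchyDevelopment D) : Prop :=
  ∃ (O : Set 𝒟.carrier) (d : FinalStateDecomposition 𝒟.toSpacetime O k),
    O = exteriorOf 𝒟.toCauchyDevelopment d.charted ∧ RaysStayInClosure 𝒟.toCauchyDevelopment O ∧
      HasExhaustiveCharts d ∧ IsFutureOriented d

/-- Hypothesis (ii) of the crux with the differentiability order `3` replaced by `k`: the outer region is
`(r₀, Λ)`-tame at order `k` (centred Minkowski-background balls of one radius, `Cᵏ` deviation `≤ Λ`,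
`C⁰` deviation `≤ 1/2`). `TameOuterAt 3 𝒟` is `TameHull.TameOuter 𝒟` (`Iff.rfl`). [cite: Anderson2004, Def. 1.1] -/
def TameOuterAt (k : ℕ) (𝒟 : VacuumCauchyDevelopment D) : Prop :=
  ∀ [𝒟.metric.HasLeviCivita], ∃ r₀ : ℝ, 0 < r₀ ∧ ∃ Λ : ℝ≥0, ∀ q ∈ outerRegion 𝒟,
    let U : Opens E4 := ⟨Metric.ball (0 : E4) r₀, Metric.isOpen_ball⟩
    ∃ Ψ : U → 𝒟.carrier, 𝒟.toSpacetime.IsLateChart (Minkowski.backgroundOn U) Set.univ (-r₀) Ψ ∧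
      (∃ x : U, (x : E4) = 0 ∧ Ψ x = q) ∧
      supCkENorm (U : Set E4) k (𝒟.toSpacetime.deviationExtend (Minkowski.backgroundOn U) Ψ) ≤
          (Λ : ℝ≥0∞) ∧
        supCkENorm (U : Set E4) 0 (𝒟.toSpacetime.deviationExtend (Minkowski.backgroundOn U) Ψ) ≤
          1 / 2

/-- Hypothesis (ii) at ALL orders: one radius `r₀`, and for every `k` a bound `Λ k` (the chart may depend on
`k`). This is the per-point content of the producer obligation `SilentHull.AllOrdersTameOuter` of the live line,
read as a hypothesis on the development. [cite: Anderson2004, Def. 1.1 and Thm 5.1] -/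
def TameOuterAllOrders (𝒟 : VacuumCauchyDevelopment D) : Prop :=
  ∀ [𝒟.metric.HasLeviCivita], ∃ r₀ : ℝ, 0 < r₀ ∧ ∀ k : ℕ, ∃ Λ : ℝ≥0, ∀ q ∈ outerRegion 𝒟,
    let U : Opens E4 := ⟨Metric.ball (0 : E4) r₀, Metric.isOpen_ball⟩
    ∃ Ψ : U → 𝒟.carrier, 𝒟.toSpacetime.IsLateChart (Minkowski.backgroundOn U) Set.univ (-r₀) Ψ ∧
      (∃ x : U, (x : E4) = 0 ∧ Ψ x = q) ∧
      supCkENorm (U : Set E4) k (𝒟.toSpacetime.deviationExtend (Minkowski.backgroundOn U) Ψ) ≤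
          (Λ : ℝ≥0∞) ∧
        supCkENorm (U : Set E4) 0 (𝒟.toSpacetime.deviationExtend (Minkowski.backgroundOn U) Ψ) ≤
          1 / 2

theorem tameOuterAt_three_iff (𝒟 : VacuumCauchyDevelopment D) : TameOuterAt 3 𝒟 ↔ TameOuter 𝒟 :=
  Iff.rfl

/-- (ii) is antitone in the order: a `Cᵏ'` bound is a `Cᵏ` bound for `k ≤ k'`. [folklore] -/
theorem tameOuterAt_of_le {k k' : ℕ} (hkk : k ≤ k') (𝒟 : VacuumCauchyDevelopment D)
    (h : TameOuterAt k' 𝒟) : TameOuterAt k 𝒟 := by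
  intro inst
  obtain ⟨r₀, hr₀, Λ, hq⟩ := @h inst
  refine ⟨r₀, hr₀, Λ, fun q hq' ↦ ?_⟩
  obtain ⟨Ψ, hΨ, hx, hk, h0⟩ := hq q hq'
  exact ⟨Ψ, hΨ, hx, (supCkENorm_mono_right _ hkk _).trans hk, h0⟩

/-- All-orders tameness gives tameness at every finite order. [folklore] -/
theorem tameOuterAt_of_allOrders (k : ℕ) (𝒟 : VacuumCauchyDevelopment D) (h : TameOuterAllOrders 𝒟) :
    TameOuterAt k 𝒟 := by
  intro inst
  obtain ⟨r₀, hr₀, hk⟩ := @h inst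
  obtain ⟨Λ, hΛ⟩ := hk k
  exact ⟨r₀, hr₀, Λ, hΛ⟩

/-- Lowering the convergence order of the settling conclusion (`FinalStateDecomposition.ofLE` keeps the charts,
hence the charted region, the exhaustion radii and the orientation). [folklore] -/
theorem settlesAt_of_le {k k' : ℕ} (hkk : k ≤ k') (𝒟 : VacuumCauchyDevelopment D) (h : SettlesAt k' 𝒟) :
    SettlesAt k 𝒟 := by
  obtain ⟨O, d, hO, hR, hE, hF⟩ := h
  refine ⟨O, d.ofLE hkk, ?_, hR, hasExhaustiveCharts_ofLE d hkk hE, (isFutureOriented_ofLE d hkk).2 hF⟩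
  rw [FinalStateDecomposition.charted_ofLE]; exact hO

end Pieces

/-! ## §1 Inventory (1): strictly-weaker typed intermediates `K2RAt k` (k ≥ 3) and `K2RAllOrders` -/

/-- **`K2RAt k`** — the consequent Φ of the crux with hypothesis (ii) at order `k`: every MGHD of admissible data
with complete `𝓘⁺`, (i) no extremal remnant and (ii)ₖ a `Cᵏ`-tame outer region settles (T2 clause, order 2).
`K2RAt 3 ↔ K2R` (`k2RAt_three_iff`, using the closed K1R); for `k ≥ 3` it is a CONSEQUENCE of the crux
(`k2RAt_mono`), and NOT known to imply it back (regularity gap: a `C³`-tame outer region need not be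
`Cᵏ`-tame, admissibility being only `o₂(r⁻¹)`). [cite: DafermosLuk2017, Conjecture 1 and §1.2.1] -/
def K2RAt (k : ℕ) : Prop :=
  ∀ (X : Type) [TopologicalSpace X] [ChartedSpace E3 X] [IsManifold (𝓡 3) ∞ X] [T2Space X]
    [SecondCountableTopology X] [ConnectedSpace X], ∀ D ∈ admissibleVacuumData X,
    ∀ 𝒟 : VacuumCauchyDevelopment D, 𝒟.IsMaximal → HasCompleteNullInfinity 𝒟.toCauchyDevelopment →
      NoExtremalRemnant 𝒟 → TameOuterAt k 𝒟 → SettlesAt 2 𝒟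

/-- **`K2RAllOrders`** — Φ with (ii) at all orders: the statement the registered line `tame-lasalle-dock`
actually proves through its producer stub (whose class `IsTameClass` carries `order : ∀ k`), i.e. the honest
endpoint of that skeleton absent a development-side all-orders regularity theorem. Strictly downstream of
the crux (`k2RAllOrders_of_k2R`). [cite: DafermosLuk2017, Conjecture 1 and §1.2.1] -/
def K2RAllOrders : Prop :=
  ∀ (X : Type) [TopologicalSpace X] [ChartedSpace E3 X] [IsManifold (𝓡 3) ∞ X] [T2Space X]
    [SecondCountableTopology X] [ConnectedSpace X], ∀ D ∈ admissibleVacuumData X,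
    ∀ 𝒟 : VacuumCauchyDevelopment D, 𝒟.IsMaximal → HasCompleteNullInfinity 𝒟.toCauchyDevelopment →
      NoExtremalRemnant 𝒟 → TameOuterAllOrders 𝒟 → SettlesAt 2 𝒟

/-- `K2RAt 3` is the crux (through the CLOSED K1R: `Disproof.k2R_iff_tameResolution`). [folklore] -/
theorem k2RAt_three_iff : K2RAt 3 ↔ ChannelsResolveTameDevelopmentsR := by
  constructor
  · intro h3
    refine k2R_of_tameResolution ?_
    intro X _ _ _ _ _ _ D hD 𝒟 hmax hscri hyp
    exact h3 X D hD 𝒟 hmax hscri hyp.1 hyp.2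
  · intro hK X _ _ _ _ _ _ D hD 𝒟 hmax hscri hi hii
    exact tameResolution_of_k2R hK X D hD 𝒟 hmax hscri ⟨hi, hii⟩

/-- Monotonicity: strengthening (ii) weakens the statement. [folklore] -/
theorem k2RAt_mono {k k' : ℕ} (hkk : k ≤ k') : K2RAt k → K2RAt k' := by
  intro h X _ _ _ _ _ _ D hD 𝒟 hmax hscri hi hii
  exact h X D hD 𝒟 hmax hscri hi (tameOuterAt_of_le hkk 𝒟 hii)

/-- Every finite-order version implies the all-orders version. [folklore] -/
theorem k2RAllOrders_of_k2RAt (k : ℕ) : K2RAt k → K2RAllOrders := by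
  intro h X _ _ _ _ _ _ D hD 𝒟 hmax hscri hi hii
  exact h X D hD 𝒟 hmax hscri hi (tameOuterAt_of_allOrders k 𝒟 hii)

/-- The crux implies each weaker intermediate. [folklore] -/
theorem k2RAt_of_k2R {k : ℕ} (hk : 3 ≤ k) (h : ChannelsResolveTameDevelopmentsR) : K2RAt k :=
  k2RAt_mono hk (k2RAt_three_iff.2 h)

theorem k2RAllOrders_of_k2R (h : ChannelsResolveTameDevelopmentsR) : K2RAllOrders :=
  k2RAllOrders_of_k2RAt 3 (k2RAt_three_iff.2 h)

/-! ## §2 Inventory (2)/(3): the two-piece dock onto the sibling target `CompleteScriSettlesC0` (stmt-17273) -/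

/-- **`TameUpgrade`** — the regularity/gauge upgrade: on the crux's class (MGHD, complete `𝓘⁺`, (i), (ii)₃), an
honest `C⁰` T2 decomposition upgrades to an honest `C²` one. Pure gauge improvement (no dynamics: the existence of
SOME settling description is assumed); expected via compactness of the tame structure + `C⁰`-isometry rigidity
(Lorentzian Myers–Steenrod) of the limits. Why it might fail: Lorentzian `C⁰`-near-isometries need not be
equicontinuous (boost drift along the late charts, cf. `Negative/TameChartsBoostBlind`). [folklore] -/
def TameUpgrade : Prop :=
  ∀ (X : Type) [TopologicalSpace X] [ChartedSpace E3 X] [IsManifold (𝓡 3) ∞ X] [T2Space X]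
    [SecondCountableTopology X] [ConnectedSpace X], ∀ D ∈ admissibleVacuumData X,
    ∀ 𝒟 : VacuumCauchyDevelopment D, 𝒟.IsMaximal → HasCompleteNullInfinity 𝒟.toCauchyDevelopment →
      NoExtremalRemnant 𝒟 → TameOuterAt 3 𝒟 → SettlesAt 0 𝒟 → SettlesAt 2 𝒟

/-- **Dock assembly (proved):** the sibling route's target T = `CompleteScriSettlesC0` (complete `𝓘⁺` ⇒ `C⁰`
settling, NO tameness assumed) together with `TameUpgrade` gives the crux. [folklore] -/
theorem k2R_of_completeScriSettlesC0_of_tameUpgrade (hT : CompleteScriSettlesC0) (hU : TameUpgrade) :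
    ChannelsResolveTameDevelopmentsR := by
  refine k2RAt_three_iff.1 ?_
  intro X _ _ _ _ _ _ D hD 𝒟 hmax hscri hi hii
  exact hU X D hD 𝒟 hmax hscri hi hii (hT X D hD 𝒟 hmax hscri)

/-- **Converse on the tame class (proved):** the crux gives T restricted to the crux's own class (order `2 ↦ 0`
by `FinalStateDecomposition.ofLE`). So on the tame class the two routes' deciding statements differ exactly by
`TameUpgrade`. [folklore] -/
theorem completeScriSettlesC0_onTameClass_of_k2R (h : ChannelsResolveTameDevelopmentsR) :
    ∀ (X : Type) [TopologicalSpace X] [ChartedSpace E3 X] [IsManifold (𝓡 3) ∞ X] [T2Space X]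
      [SecondCountableTopology X] [ConnectedSpace X], ∀ D ∈ admissibleVacuumData X,
      ∀ 𝒟 : VacuumCauchyDevelopment D, 𝒟.IsMaximal → HasCompleteNullInfinity 𝒟.toCauchyDevelopment →
        NoExtremalRemnant 𝒟 → TameOuterAt 3 𝒟 → SettlesAt 0 𝒟 := by
  intro X _ _ _ _ _ _ D hD 𝒟 hmax hscri hi hii
  exact settlesAt_of_le (Nat.zero_le 2) 𝒟 (k2RAt_three_iff.2 h X D hD 𝒟 hmax hscri hi hii)


/-! ## §3 Re-indexing the ROUTE: `closes` survives at every order (the all-orders re-type is free downstream) -/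

/-- K3 = `TameCensorship` with hypothesis (ii) at order `k` (`TameCensorshipAt 3` is the route's K3 up to
unfolding). Raising `k` STRENGTHENS the generic property but — because Christodoulou genericity is existential
(one tame curve through each exceptional datum) — regularity-type exceptional data are absorbed by truncation
families, so `TameCensorshipAt k` / `TameCensorshipAllOrders` are not less plausible than K3 (census §1).
[cite: Christodoulou1999, p. A24] -/
def TameCensorshipAt (k : ℕ) : Prop :=
  ∀ (X : Type) [TopologicalSpace X] [ChartedSpace E3 X] [IsManifold (𝓡 3) ∞ X] [T2Space X]
    [SecondCountableTopology X] [ConnectedSpace X],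
    InitialDataSet.IsTameChristodoulouGeneric (admissibleVacuumData X)
      (fun D ↦ (∃ 𝒟 : VacuumCauchyDevelopment D, 𝒟.IsMaximal) ∧
        ∀ 𝒟 : VacuumCauchyDevelopment D, 𝒟.IsMaximal →
          HasCompleteNullInfinity 𝒟.toCauchyDevelopment ∧ (NoExtremalRemnant 𝒟 ∧ TameOuterAt k 𝒟)) 1

/-- K3 at all orders. [cite: Christodoulou1999, p. A24] -/
def TameCensorshipAllOrders : Prop :=
  ∀ (X : Type) [TopologicalSpace X] [ChartedSpace E3 X] [IsManifold (𝓡 3) ∞ X] [T2Space X]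
    [SecondCountableTopology X] [ConnectedSpace X],
    InitialDataSet.IsTameChristodoulouGeneric (admissibleVacuumData X)
      (fun D ↦ (∃ 𝒟 : VacuumCauchyDevelopment D, 𝒟.IsMaximal) ∧
        ∀ 𝒟 : VacuumCauchyDevelopment D, 𝒟.IsMaximal →
          HasCompleteNullInfinity 𝒟.toCauchyDevelopment ∧ (NoExtremalRemnant 𝒟 ∧ TameOuterAllOrders 𝒟)) 1

/-- Tame Christodoulou genericity is monotone in the property (verbatim the `mono` step of the route's
`closes`). [cite: Christodoulou1999, p. A24] -/
theorem isTameChristodoulouGeneric_mono {X : Type} [TopologicalSpace X] [ChartedSpace E3 X]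
    [IsManifold (𝓡 3) ∞ X] {P Q : InitialDataSet (𝓡 3) X → Prop}
    (hQP : ∀ D ∈ admissibleVacuumData X, Q D → P D)
    (hQ : InitialDataSet.IsTameChristodoulouGeneric (admissibleVacuumData X) Q 1) :
    InitialDataSet.IsTameChristodoulouGeneric (admissibleVacuumData X) P 1 := by
  intro D hD
  obtain ⟨e, F, hF, himm, h0, hinj, hadm, hexc⟩ := hQ D ⟨hD.1, fun h => hD.2 (hQP D hD.1 h)⟩
  exact ⟨e, F, hF, himm, h0, hinj, hadm,
    fun c hc hmem => hexc c hc ⟨hmem.1, fun h => hmem.2 (hQP _ hmem.1 h)⟩⟩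

/-- **The route decides the summit at EVERY order `k`** (same proof as `Theses.PhotonSphereChannels.closes`,
K1R being closed): re-indexing (ii) from `3` to any `k`, in K2R and K3 simultaneously, costs nothing downstream.
[cite: DafermosLuk2017, Conjecture 1 and §1.2.1] -/
theorem finalStateConjecture_of_at (k : ℕ) (h₂ : K2RAt k) (h₃ : TameCensorshipAt k) :
    _root_.FinalStateConjecture := by
  intro X i₁ i₂ i₃ i₄ i₅ i₆
  refine isTameChristodoulouGeneric_mono ?_ (h₃ X)
  rintro D hD ⟨hex, hQ⟩
  refine ⟨hex, fun 𝒟 hmax => ?_⟩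
  obtain ⟨hcomp, hi, hii⟩ := hQ 𝒟 hmax
  obtain ⟨O, d, hO, hrays, hexh, hfo⟩ := h₂ X D hD 𝒟 hmax hcomp hi hii
  refine ⟨hcomp, O, d, fun i => ?_, hO, hrays, hexh, hfo⟩
  rcases lt_or_eq_of_le (d.abs_spin_le_mass i) with hlt | heq
  · exact hlt
  · exact absurd ⟨d.τ₀, d.chart i, ⟨(d.isLateChart i).contMDiff, (d.isLateChart i).isOpenEmbedding,
        Set.subset_univ _⟩, d.tendsto_truncDeviationCk i⟩
      (hi (d.motion i).1 (d.motion i).2 (d.mass i) (d.spin i) ⟨heq, d.mass_pos i⟩)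

/-- **… and at all orders**: `K2RAllOrders → TameCensorshipAllOrders → FinalStateConjecture`. This is the
`closes` of the honest re-type in which the live line's all-orders producer debt (F0) is a standing hypothesis
instead of a (false, census §1) universal claim about `C³`-tame developments. [cite: DafermosLuk2017, Conjecture 1 and §1.2.1] -/
theorem finalStateConjecture_of_allOrders (h₂ : K2RAllOrders) (h₃ : TameCensorshipAllOrders) :
    _root_.FinalStateConjecture := by
  intro X i₁ i₂ i₃ i₄ i₅ i₆
  refine isTameChristodoulouGeneric_mono ?_ (h₃ X)
  rintro D hD ⟨hex, hQ⟩
  refine ⟨hex, fun 𝒟 hmax => ?_⟩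
  obtain ⟨hcomp, hi, hii⟩ := hQ 𝒟 hmax
  obtain ⟨O, d, hO, hrays, hexh, hfo⟩ := h₂ X D hD 𝒟 hmax hcomp hi hii
  refine ⟨hcomp, O, d, fun i => ?_, hO, hrays, hexh, hfo⟩
  rcases lt_or_eq_of_le (d.abs_spin_le_mass i) with hlt | heq
  · exact hlt
  · exact absurd ⟨d.τ₀, d.chart i, ⟨(d.isLateChart i).contMDiff, (d.isLateChart i).isOpenEmbedding,
        Set.subset_univ _⟩, d.tendsto_truncDeviationCk i⟩
      (hi (d.motion i).1 (d.motion i).2 (d.mass i) (d.spin i) ⟨heq, d.mass_pos i⟩)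

/-- Sanity: at order 3 this is the route's own deciding theorem (K1R closed). [folklore] -/
theorem tameCensorshipAt_three_iff :
    TameCensorshipAt 3 ↔ Summit.FinalStateConjecture.FinalStateConjecture.Theses.PhotonSphereChannels.TameCensorship :=
  Iff.rfl

end Summit.FinalStateConjecture.FinalStateConjecture.Cruxes.ChannelsResolveTameDevelopmentsR.StrategistS4

end
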